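import Mathlib
import Summits.PneNP.PneNP.Theses.Nc03AvoidResidualCore
import Summits.PneNP.PneNP.Theorems.SfmBlCandAvoidLinearFP
import Summits.PneNP.PneNP.Theorems.Nc03AvoidResidualCoreCandStarReduction
import Summits.PneNP.PneNP.Theorems.Nc03AvoidResidualCoreResidualCoreReduction

/-!
# Route Nc03AvoidResidualCore — the rung leaf `Nc03AvoidLinearFP` (stmt-PneNP-19007), by name

Rung F-N1b of the PneNP frontier ladder (cell pnp-ideate): `NC⁰₃` range avoidance at linear stretch is
solved by one polynomial-time function — `LocalAvoidLinearFP 3 (fun _ _ _ => True)`.  This file only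
composes the route's deciding theorem `Theses.Nc03AvoidResidualCore.closes` with the three landed binder
proofs: `SfmBlMachine.candMatchAvoidLinearFP` (X₁, stmt-PneNP-19962; the derandomised cut-norm signing
line «sfm-bl», p564509/p566473), `candStarReduction_proof` (stmt-PneNP-19963) and
`residualCoreReduction_proof` (stmt-PneNP-20227).  FRONTIER: a restricted-model ALGORITHMIC rung
(ALT-CLOSER, D-0061) established by the cell's kernel check; it is not the summit and says nothing about
`P ≠ NP`.
-/

set_option linter.dupNamespace false -- `Summit.PneNP.PneNP.…`: summit = sub-problem name (D-0017 single-conjunct layout)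

namespace Summit.PneNP.PneNP.Theorems

/-- **Rung F-N1b (leaf `Nc03AvoidLinearFP`, stmt-PneNP-19007):** `NC⁰₃-AVOID` at linear stretch is in
FP — there are an absolute `C` and one polynomial-time string function which, for every 3-local map with
`n ≥ 1` inputs and `m ≥ C·n` outputs, outputs a point outside its range.  Proof: the route's deciding
theorem applied to the three proved binders. -/
theorem nc03AvoidLinearFP : Summit.PneNP.PneNP.Theses.Nc03AvoidResidualCore.Nc03AvoidLinearFP :=
  Summit.PneNP.PneNP.Theses.Nc03AvoidResidualCore.closes
    Summit.PneNP.PneNP.Theorems.SfmBlMachine.candMatchAvoidLinearFP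
    candStarReduction_proof residualCoreReduction_proof

/-- The same statement with the leaf unfolded: `LocalAvoidLinearFP 3 (fun _ _ _ => True)`. -/
theorem nc03_localAvoidLinearFP :
    Literature.Computability.Complexity.LocalAvoidLinearFP 3 (fun _ _ _ => True) :=
  nc03AvoidLinearFP

end Summit.PneNP.PneNP.Theorems
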